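import Summits.QuantumFields.YangMills.Theorems.BalabanLadderNTWeakPackageTwoPoint
import HarnessLib

/-!
# Route `SqueezedSkewness`, support `CollarBumpFloors` (stmt-QuantumFields-23680) — the windowed two-point floor

Helper file (`--supports stmt-QuantumFields-19353`, fleet lead `ym-spine-19353-p1` g20).  The spine's two-point floor
(`StubLower.lowerBounds_twoPoint`, `NT.WeakPackage.lowerBounds_twoPoint_weak`) produces ONE bump `v` at ONE femto height with
`ε ≤ Q2(θv, v)`.  `CollarBumpFloors` (LINE χ₂ «femto currency» of planner ym-idea-6 g12) needs the same floor for bumps of EVERY radius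
`ρ > 0` near `e₀` and UNIFORMLY over the femto window of time-translates `f = v(· + τ e₀)` whose lower support edge `δ₁ − τ` lies in
`[h₁, 3h₁]`.  This file re-runs the spine's proof with the radius and the height as parameters (`twoPoint_floor_window`):

* the femto scale `σ = min(δ_K, δ_Γ/2, ℓ/100, 1)` of the spine (`ℓ = min ℓ₁ ℓ₂`, `s K(s) < ℓ/100` below `δ_K`, `Γ(t)/t⁸ > M` below `δ_Γ`),
  the window height `h₁ = σ/12` and the bump radius `ρ⋆ = min(ρ, σ/8)`, so that every pair scale `S = 2(1 − τ) ∈ [2h₁ + 4ρ⋆, 6h₁ + 4ρ⋆]`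
  is `≤ σ` and the spine's per-pair floor `pair_floor_weak` applies verbatim at scale `S`;
* `v` = the smooth bump at `e₀` with plateau radius `ρ⋆/2` and support radius `ρ⋆` (`exists_bump_schwartz`), slab `(1 − 2ρ⋆, 1 + 2ρ⋆)`;
* the plateau Riemann masses `(ρ⋆/(4a))⁴` of `f` and `θf` (`pow_le_sum_box`) and the summation `mul_sum_mul_sum_le` give
  `Q2(θf, f) ≥ (c₂M/2)(ρ⋆/4)⁸ = 3ε` for `β ≥ β₅`, `a(β)L ≥ Λ₅`, every translate in the window.

Inputs: `FBL G r a` and `FC2 G r a` (only the lower half of `FC2` on x-centred cubes in the forward cone is used, as in the spine).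
HONEST FRAMING: a CONDITIONAL floor (`FBL`, `FC2` are hypotheses = the spine's femto two-point package, NOT proved); no crux, NT
statement (stmt-QuantumFields-19353) or mass gap follows. [folklore]
-/

set_option autoImplicit false

noncomputable section

open scoped SchwartzMap
open MeasureTheory Filter Topology Metric
open Literature.MathematicalPhysics.QuantumFieldTheory Literature.MathematicalPhysics.QuantumLattice
open Literature.MathematicalPhysics.AQFT Literature.Probability.LatticeModels
open Summit.QuantumFields.YangMills.Theorems.OSLegsFromFemtoAndGap.StubLower
open Summit.QuantumFields.YangMills.Cruxes.OSLegsFromFemtoAndGap.DlrCollarTransfer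
open Summit.QuantumFields.YangMills.Cruxes.OSLegsFromFemtoAndGap.DlrCollarTransfer.StubLower
open Summit.QuantumFields.YangMills.Cruxes.NT.WeakPackage (pair_floor_weak)

namespace Summit.QuantumFields.YangMills.Theorems.CollarBumpTwoPoint

/-! ## §1 Translates of a bump -/

/-- `z + τ e₀ − e₀ = z − (1 − τ) e₀`. [folklore] -/
theorem add_smul_single_sub (z : EuclideanSpace ℝ (Fin 4)) (τ : ℝ) :
    z + τ • EuclideanSpace.single (0 : Fin 4) (1 : ℝ) - EuclideanSpace.single 0 1 =
      z - EuclideanSpace.single 0 (1 - τ) := by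
  ext j
  by_cases hj : j = 0
  · subst hj; simp; ring
  · simp [hj]

/-- The support of a translate `f = v(· + w)` is the translated support. [folklore] -/
theorem tsupport_translate_subset {v f : EuclideanSpace ℝ (Fin 4) → ℝ} {w : EuclideanSpace ℝ (Fin 4)}
    (hf : ∀ y, f y = v (y + w)) : tsupport f ⊆ (fun y => y + w) ⁻¹' tsupport v := by
  have hfe : f = v ∘ (fun y => y + w) := funext fun y => hf y
  rw [hfe]
  exact tsupport_comp_subset_preimage v (continuous_add_const w)

section Window

variable (G : Type) [Group G] [TopologicalSpace G] [IsTopologicalGroup G] [CompactSpace G]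
  [MeasurableSpace G] [BorelSpace G] (r : LatticeRep G) (a : ℝ → ℝ)

/-! ## §2 The windowed two-point floor -/

/-- **The two-point floor for bumps of every radius, uniformly over the femto window.**  From `FBL G r a` and `FC2 G r a` (units
`0 < a → 0`): for every `ρ > 0` there are a bump `v ≥ 0` supported in `closedBall(e₀, ρ)` and in a slab `{δ₁ < y₀ < δ₂}` (`δ₁ > 0`), a
femto height `h₁ > 0` with `3h₁ ≤ δ₁`, and `ε > 0`, `β₅`, `Λ₅` such that every translate `f = v(· + τ e₀)` with lower edge
`δ₁ − τ ∈ [h₁, 3h₁]` has `3ε ≤ Q2 G r β L (a β) (θf) f` for `β ≥ β₅`, `a(β)L ≥ Λ₅` (the spine's `lowerBounds_twoPoint_weak` with radius and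
height as parameters: femto scale `σ`, `h₁ = σ/12`, radius `ρ⋆ = min(ρ, σ/8)`, per-pair floor `pair_floor_weak` at the pair scale
`S = 2(1 − τ) ≤ σ`, plateau Riemann masses). [folklore] -/
theorem twoPoint_floor_window (hapos : ∀ β, 0 < a β) (hlim : Tendsto a atTop (𝓝 0)) (hFBL : FBL G r a)
    (hFC2 : FC2 G r a) (ρ : ℝ) (hρ : 0 < ρ) :
    ∃ (v : 𝓢(EuclideanSpace ℝ (Fin 4), ℝ)), (∀ x, 0 ≤ v x) ∧
      tsupport (v : EuclideanSpace ℝ (Fin 4) → ℝ) ⊆ closedBall (EuclideanSpace.single (0 : Fin 4) (1 : ℝ)) ρ ∧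
      ∃ (δ₁ δ₂ h₁ ε β₅ Λ₅ : ℝ), 0 < δ₁ ∧
        tsupport (v : EuclideanSpace ℝ (Fin 4) → ℝ) ⊆ {y : EuclideanSpace ℝ (Fin 4) | δ₁ < y 0 ∧ y 0 < δ₂} ∧
        0 < h₁ ∧ 3 * h₁ ≤ δ₁ ∧ 0 < ε ∧
        ∀ β : ℝ, β₅ ≤ β → ∀ L : ℕ, Λ₅ ≤ a β * L → ∀ (τ : ℝ) (f : 𝓢(EuclideanSpace ℝ (Fin 4), ℝ)),
          h₁ ≤ δ₁ - τ → δ₁ - τ ≤ 3 * h₁ → (∀ y, f y = v (y + τ • EuclideanSpace.single (0 : Fin 4) (1 : ℝ))) →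
            3 * ε ≤ Q2 G r β L (a β) (thetaTest 4 f) f := by
  obtain ⟨C₁, β₁, ℓ₁, p, hℓ₁, hC₁, hFBLc⟩ := hFBL
  -- the weak floor clause (F): x-centred cubes, lower half (as `NT.WeakPackage.floor_of_fc2`)
  obtain ⟨Γ, β₂, ℓ₂, c₂, C₂, K, n₀, hℓ₂, hc₂, hK1, hKlim, hn₀, -, -, hΓlim, hFC2c⟩ := hFC2
  have hFc : ∀ β : ℝ, β₂ ≤ β → ∀ (x : Fin 4 → ℤ) (R : ℕ), ((2 * R + 1 : ℕ) : ℝ) * a β ≤ ℓ₂ →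
      ∀ (η : LGConfig 4 G) (y : Fin 4 → ℤ) (s₀ : ℝ), 0 < s₀ → s₀ ≤ ‖siteToE (y - x)‖ * a β →
        (n₀ : ℝ) ≤ ‖siteToE (y - x)‖ → ‖siteToE (y - x)‖ < 3 * siteToE (y - x) 0 →
          K s₀ * ‖siteToE (y - x)‖ ≤ depth (fun j => x j - R) (2 * R + 1) y →
            c₂ * Γ (‖siteToE (y - x)‖ * a β) ≤
              ‖siteToE (y - x)‖ ^ 8 * kerCov G r β (fun j => x j - R) (2 * R + 1) η (dens G r x) (dens G r y) := by
    intro β hβ x R hb η y s₀ hs₀ hs₀le hn _hcone hKy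
    have hyx : (depth (fun j => x j - R) (2 * R + 1) y : ℝ) ≤ depth (fun j => x j - R) (2 * R + 1) x := by
      have h1 : (depth (fun j => x j - R) (2 * R + 1) y : ℝ) ≤ (R : ℝ) + 1 := by
        have h0 : depth (fun j => x j - R) (2 * R + 1) y ≤ R + 1 := by
          have h : depth (fun j => x j - R) (2 * R + 1) y ≤
              min (y 0 - (x 0 - R) + 1).toNat ((x 0 - R) + (2 * R + 1 : ℕ) - y 0).toNat := by
            unfold depth
            exact Finset.inf'_le _ (Finset.mem_univ (0 : Fin 4))
          omega
        exact_mod_cast h0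
      have h2 : (R : ℝ) + 1 ≤ depth (fun j => x j - R) (2 * R + 1) x := by
        have := le_depth_cube x x R (t := 0) (fun j => by simp)
        linarith
      exact h1.trans h2
    exact (hFC2c β hβ _ _ hb η x y s₀ hs₀ hs₀le hn (hKy.trans hyx) hKy).1
  -- the constants of the spine
  obtain ⟨ℓ, hℓ⟩ : ∃ ℓ : ℝ, ℓ = min ℓ₁ ℓ₂ := ⟨_, rfl⟩
  have hℓ0 : 0 < ℓ := by rw [hℓ]; exact lt_min hℓ₁ hℓ₂
  have hℓℓ₁ : ℓ ≤ ℓ₁ := hℓ ▸ min_le_left _ _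
  have hℓℓ₂ : ℓ ≤ ℓ₂ := hℓ ▸ min_le_right _ _
  obtain ⟨D, hD⟩ : ∃ D : ℝ, D = ℓ / 100 := ⟨_, rfl⟩
  have hD0 : 0 < D := by rw [hD]; positivity
  obtain ⟨M, hM⟩ : ∃ M : ℝ, M = 8 * C₁ ^ 2 / (c₂ * D ^ 8) + 1 := ⟨_, rfl⟩
  have hM0 : 0 < M := by rw [hM]; positivity
  have hMC : 4 * C₁ ^ 2 / D ^ 8 ≤ c₂ * M / 2 := by
    have : c₂ * M / 2 = 4 * C₁ ^ 2 / D ^ 8 + c₂ / 2 := by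
      rw [hM]; field_simp; ring
    rw [this]; linarith
  obtain ⟨δK, hδK, hKδ⟩ := exists_delta_of_tendsto_mul hKlim (ε := ℓ / 100) (by positivity)
  obtain ⟨δΓ, hδΓ, hΓδ⟩ := exists_delta_of_tendsto_div_atTop hΓlim M
  -- the femto scale, the window height and the radius
  obtain ⟨σ, hσ⟩ : ∃ σ : ℝ, σ = min (min δK (δΓ / 2)) (min (ℓ / 100) 1) := ⟨_, rfl⟩
  have hσ0 : 0 < σ := by rw [hσ]; positivity
  have hσK : σ ≤ δK := by rw [hσ]; exact (min_le_left _ _).trans (min_le_left _ _)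
  have hσΓ : σ ≤ δΓ / 2 := by rw [hσ]; exact (min_le_left _ _).trans (min_le_right _ _)
  have hσℓ : σ ≤ ℓ / 100 := by rw [hσ]; exact (min_le_right _ _).trans (min_le_left _ _)
  have hσ1 : σ ≤ 1 := by rw [hσ]; exact (min_le_right _ _).trans (min_le_right _ _)
  obtain ⟨h₁, hh₁⟩ : ∃ h₁ : ℝ, h₁ = σ / 12 := ⟨_, rfl⟩
  have hh₁0 : 0 < h₁ := by rw [hh₁]; positivity
  obtain ⟨ρs, hρs⟩ : ∃ ρs : ℝ, ρs = min ρ (σ / 8) := ⟨_, rfl⟩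
  have hρs0 : 0 < ρs := by rw [hρs]; exact lt_min hρ (by positivity)
  have hρsρ : ρs ≤ ρ := by rw [hρs]; exact min_le_left _ _
  have hρsσ : ρs ≤ σ / 8 := by rw [hρs]; exact min_le_right _ _
  -- the bump at `e₀`: plateau radius `ρs/2`, support radius `ρs`
  obtain ⟨v, hv0, -, hvone, hvsupp, hvts⟩ :=
    exists_bump_schwartz (EuclideanSpace.single (0 : Fin 4) (1 : ℝ)) (ρ := ρs / 2) (by positivity)
  have h2ρ : 2 * (ρs / 2) = ρs := by ring
  rw [h2ρ] at hvsupp hvts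
  -- small spacings
  have hn₀0 : (0 : ℝ) < n₀ := by exact_mod_cast hn₀
  obtain ⟨β₀, hβ₀⟩ := exists_of_tendsto_atTop_nhds_zero hlim
    (a₀ := min (ℓ / 100) (min (h₁ / n₀) (ρs / 4))) (by positivity)
  refine ⟨v, hv0, ?_, 1 - 2 * ρs, 1 + 2 * ρs, h₁, c₂ * M / 2 * (ρs / 4) ^ 8 / 3, max β₀ (max β₁ β₂), max ℓ 2,
    by linarith, ?_, hh₁0, by linarith, by positivity, ?_⟩
  · rw [hvts]; exact closedBall_subset_closedBall hρsρ
  · -- the slab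
    rw [hvts]
    intro y hy
    rw [mem_closedBall, dist_eq_norm] at hy
    have h1 := abs_apply_le_norm (y - EuclideanSpace.single 0 (1 : ℝ)) 0
    have h2 : |y 0 - 1| ≤ ρs := by simpa using h1.trans hy
    constructor
    · show 1 - 2 * ρs < y 0
      have := (abs_le.1 h2).1; linarith
    · show y 0 < 1 + 2 * ρs
      have := (abs_le.1 h2).2; linarith
  intro β hβ L hL τ f hτ1 hτ2 hf
  have hββ₀ : β₀ ≤ β := le_of_max_le_left hβ
  have hββ₁ : β₁ ≤ β := le_of_max_le_left (le_of_max_le_right hβ)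
  have hββ₂ : β₂ ≤ β := le_of_max_le_right (le_of_max_le_right hβ)
  have hα := hapos β
  have hαa₀ := hβ₀ β hββ₀
  have hαℓ : a β ≤ ℓ / 100 := (hαa₀.trans_le (min_le_left _ _)).le
  have hαn : a β ≤ h₁ / n₀ := (hαa₀.trans_le ((min_le_right _ _).trans (min_le_left _ _))).le
  have hαρ : a β ≤ ρs / 4 := (hαa₀.trans_le ((min_le_right _ _).trans (min_le_right _ _))).le
  have hLℓ : ℓ ≤ a β * L := (le_max_left _ _).trans hL
  have hL2 : 2 ≤ a β * L := (le_max_right _ _).trans hL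
  -- the pair scale of this translate
  obtain ⟨S, hS⟩ : ∃ S : ℝ, S = 2 * (1 - τ) := ⟨_, rfl⟩
  have hS2 : S / 2 = 1 - τ := by rw [hS]; ring
  have hSlo : 2 * h₁ + 4 * ρs ≤ S := by rw [hS]; linarith
  have hShi : S ≤ 6 * h₁ + 4 * ρs := by rw [hS]; linarith
  have hSσ : S ≤ σ := by
    have : 6 * h₁ + 4 * ρs ≤ σ := by rw [hh₁]; linarith
    linarith
  have hS0 : 0 < S := by linarith
  have hSδΓ : 3 * S / 2 < δΓ := by linarith
  have hSℓ : S ≤ ℓ / 100 := hSσ.trans hσℓ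
  have hSK : S * K (S / 2) < 2 * ℓ / 100 := by
    have := hKδ (S / 2) (by positivity) (by linarith)
    linarith
  have hαn₀ : (n₀ : ℝ) * a β ≤ S / 2 := by
    rw [le_div_iff₀ (by positivity)] at hαn; linarith
  obtain ⟨hfem₁, hfem₂, hL'⟩ := femto_budget (L := L) hℓℓ₁ hℓℓ₂ hSℓ hS0 hSK hαℓ hLℓ
  rw [← hD] at hfem₁ hfem₂ hL'
  -- values of the translate: `f z ≠ 0` forces `z` within `ρs` of `(1 - τ) e₀`; `f = 1` on the plateau
  have hfz : ∀ z : EuclideanSpace ℝ (Fin 4), f z ≠ 0 → ‖z - EuclideanSpace.single 0 (S / 2)‖ < ρs := by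
    intro z hz
    rw [hf z] at hz
    have h := hvsupp _ hz
    rwa [dist_eq_norm, add_smul_single_sub, ← hS2] at h
  have hf1 : ∀ z : EuclideanSpace ℝ (Fin 4), dist z (EuclideanSpace.single 0 (S / 2)) ≤ ρs / 2 → f z = 1 := by
    intro z hz
    rw [hf z]
    refine hvone _ ?_
    rwa [dist_eq_norm, add_smul_single_sub, ← hS2, ← dist_eq_norm]
  have hf0 : ∀ z : EuclideanSpace ℝ (Fin 4), 0 ≤ f z := fun z => by rw [hf z]; exact hv0 _
  have hρS : ρs < S / 4 := by linarith
  -- the per-pair floor at the pair scale `S`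
  have key : ∀ x y : Fin 4 → ℤ, thetaTest 4 f (a β • siteToE x) ≠ 0 → f (a β • siteToE y) ≠ 0 →
      c₂ * M / 2 * a β ^ 8 ≤ torusE G r β L (fun U => dens G r x U * dens G r y U)
        - torusE G r β L (dens G r x) * torusE G r β L (dens G r y) := by
    intro x y hx hy
    refine pair_floor_weak G r a hC₁ hFBLc hc₂ hK1 hFc hS0 hD0 hΓδ hSδΓ hMC hββ₁ hββ₂ hα hαn₀
      hfem₁ hfem₂ hL' x y ?_ ?_
    · rw [thetaTest_apply] at hx
      have := hfz _ hx
      rw [norm_timeReflection_sub_single] at this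
      linarith
    · have := hfz _ hy
      linarith
  -- Riemann mass of the two plateaux
  have hS21 : S / 2 ≤ 1 := by linarith
  have hcover : ∀ j, |(EuclideanSpace.single (0 : Fin 4) (S / 2) : EuclideanSpace ℝ (Fin 4)) j|
      + ρs / 2 ≤ a β * L := fun j => by
    have : |(EuclideanSpace.single (0 : Fin 4) (S / 2) : EuclideanSpace ℝ (Fin 4)) j| ≤ S / 2 := by
      rw [PiLp.single_apply]
      split_ifs
      · rw [abs_of_pos (by positivity)]
      · rw [abs_zero]; positivity
    linarith
  have hρa : 2 * a β ≤ ρs / 2 := by linarith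
  have hSy : (ρs / 2 / (2 * a β)) ^ 4 ≤ ∑ y ∈ box 4 L, f (a β • siteToE y) :=
    pow_le_sum_box hf0 hα (fun z hz => hf1 z hz) hρa hcover
  have hSx : (ρs / 2 / (2 * a β)) ^ 4 ≤ ∑ x ∈ box 4 L, thetaTest 4 f (a β • siteToE x) := by
    refine pow_le_sum_box (p := -EuclideanSpace.single 0 (S / 2)) (fun z => ?_) hα
      (fun z hz => ?_) hρa (fun j => by simpa using hcover j)
    · rw [thetaTest_apply]; exact hf0 _
    · rw [thetaTest_apply]
      refine hf1 _ ?_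
      rwa [dist_eq_norm, norm_timeReflection_sub_single, ← sub_neg_eq_add, ← dist_eq_norm]
  -- summation
  have hsum := mul_sum_mul_sum_le (B := box 4 L) (κ := c₂ * M / 2 * a β ^ 8)
    (f := fun x => thetaTest 4 f (a β • siteToE x)) (g := fun y => f (a β • siteToE y))
    (C := fun x y => torusE G r β L (fun U => dens G r x U * dens G r y U)
      - torusE G r β L (dens G r x) * torusE G r β L (dens G r y))
    (fun x => by rw [thetaTest_apply]; exact hf0 _) (fun y => hf0 _) key
  unfold Q2
  refine le_trans ?_ hsum
  have hα0 : a β ≠ 0 := hα.ne'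
  calc 3 * (c₂ * M / 2 * (ρs / 4) ^ 8 / 3)
      = c₂ * M / 2 * a β ^ 8 * ((ρs / 2 / (2 * a β)) ^ 4 * (ρs / 2 / (2 * a β)) ^ 4) := by
        field_simp; ring
    _ ≤ _ := mul_le_mul_of_nonneg_left (mul_le_mul hSx hSy (by positivity)
        ((by positivity : (0 : ℝ) ≤ (ρs / 2 / (2 * a β)) ^ 4).trans hSx)) (by positivity)

end Window

end Summit.QuantumFields.YangMills.Theorems.CollarBumpTwoPoint

end
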